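import Summits.QuantumFields.YangMills.Theorems.BalabanUVNodesN14ConvexFibreTilt
import Literature.MathematicalPhysics.QuantumFieldTheory.Balaban1983to89.T4DressingDefect
import Literature.Barriers.CriticalPhenomena.RigorousRGSmallParameterKochWittwerReduction

/-!
# BalabanUVNodes ∕ node N14 = NE1′ — THE PRODUCER OF THE RESIDUAL ON THE CONSISTENT CONVEX TOWER: the two-run tilted mean
# matching across one convex fibre is SECOND ORDER IN THE FIBRE GRADIENT (the young rate squared), hence `TiltedMeanMatching`

Cell `pub-ymgap`, HUMAN RULING D-0062 (Track A at full width), seat `pub-ymgap-dag-n14-c` (R134 ACCELERATION, strategy s1), generation 4;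
route `Summits/QuantumFields/YangMills/Theses/BalabanUVNodes.lean` (cluster K3′ `SpineGivenEndpointR12`, `--supports … --as helper`); venue
ruling R424 (`YangMills/Theorems`, namespace `YMDAG.N14.ConvexFibreMatching`).  Seventh file of the convex-fibre engine (A `…Engine`, B
`…Window`, C `…Step`, D `…Box`, E `…Tilt`, F `…Perturb`).  ADDITIVE — imports E (hence A–C and the gaps-ne1 `Spine/NE1p` tilted-mean
calculus `DressedMGFForm.tiltedMean` ∕ `TiltedMeanMatching` ∕ `TiltedMeanInfluence.hasDerivAt_tiltedMean`) and `Literature/…/T4DressingDefect`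
(`mul_integral_le_cgf`, Jensen's half of the born cumulant, CITED) and `Literature/Barriers/CriticalPhenomena/…KochWittwerReduction`
(`HierarchicalRG.tilted_smul_measure`, CITED per the gate's `dedup.landed`); THEOREMS ONLY (0 `def`).

WHY.  The residual binder of N14 is `DressedMGFForm.TiltedMeanMatching` (:253): two runs' source-tilted first moments agree within a
SUMMABLE `η K`.  File B §3 fed the variance socket with two SEPARATE variance bounds — honest but bounded, not summable.  On a CONSISTENT
tower (run B = run A ⊗ₘ one more fibre `κ`; run A's observable = the fibre average `Ḡ` of run B's `G`) the STEP structure does better: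
by `compProd_tilted` (E) the tilted run B is the background tilted by the FIBRE CUMULANT composed with the TILTED fibres, so
`tiltedMean G (ν ⊗ₘ κ) s − tiltedMean Ḡ ν s` splits into (a) tilted fibre mean − fibre mean, `≤ |s|·(tilted fibre variance) ≤ |s|·L²∕(λ − l₀M)`
(B's letter), and (b) background tilted by the fibre cumulant vs by `s·Ḡ`, which differ by the fibre's born cumulant `∈ [0, (L²∕λ)s²∕2]` (A's
Herbst bound + Jensen `T4DressingDefect.mul_integral_le_cgf`), costing `≤ B₀·(e^{L²s²∕λ} − 1)`.  BOTH pieces are O((fibre gradient)²): the young rate squared — the «second small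
factor» the visibility ledger of `Spine/NE1p/TiltedMeanVisibility` «does NOT buy».

WHAT THIS IS.
* §1 GENERIC TILT LEMMAS [folklore]: `tiltedMean_zero_eq_integral`, `abs_tiltedMean_sub_integral_le` (mean value on `hasDerivAt_tiltedMean`
  under a tilted-variance bound), `two_sub_exp_le_exp_neg`, `abs_integral_tilted_sub_tilted_le` (two
  tilts with `|f₁ − f₂| ≤ δ`, `|h| ≤ H` ⇒ `|∫h dν.tilted f₁ − ∫h dν.tilted f₂| ≤ H·(e^{2δ} − 1)`).
* §2 **`abs_tiltedMean_compProd_sub_le`** — background `ν` (probability, any space), convex fibre kernel `κ b = e^{−V(b,·)}dx∕Z_b` (every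
  `V (b,·) ∈ C¹` `λ`-convex), observable `G` measurable, `|G| ≤ B₀`, every `G (b,·) ∈ C¹` with fibre gradient `≤ L` (`L > 0`) and two-sided
  letter `M`, `l₀M < λ`, `|s| ≤ l₀`:  `|tiltedMean G (ν ⊗ₘ κ) s − tiltedMean Ḡ ν s| ≤ |s|·L²∕(λ − l₀M) + B₀·(e^{L²s²∕λ} − 1)`.
* §3 **`tiltedMeanMatching_of_consistentConvexTower`** — the K-indexed binder: runs `ν K τ` on `Ω K`, fibres `κ K` (convex, gradient sizes
  `L K`), `Ω′ K = Ω K × E_K`, `ν′ K τ = ν K τ ⊗ₘ κ K`, `F′ K = G K`, `F K = fibre average of G K` ⇒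
  `TiltedMeanMatching l₀ T Bad F ν F′ ν′ (fun K => l₀·(L K)²∕(λ − l₀M) + B₀·(e^{(L K)²l₀²∕λ} − 1))` — summable iff `Σ (L K)² < ∞`.

WHAT THIS IS NOT.  Everything here is PROVED (0 `sorry`, 0 named facts).  The CONSISTENT-TOWER hypothesis (run K's law IS the marginal of
run K+1's law, run K's observable IS the fibre average) is the template's idealisation: for Bałaban's runs the marginal of run K+1 is run K only
up to the renormalisation-group corrections — that discrepancy is NE5∕NE7's content, not produced here; the convexity of the history-conditioned
fibre actions uniformly in the history is NODE O's positivity statement.  Nothing of Bałaban's instantiated; N14 NOT discharged;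
`TiltedMeanMatching` instantiated on the TEMPLATE tower only; count-neutral.  One finite four-torus programme at fixed ε; NOT ℝ⁴, NOT OS,
NOT a mass gap, NOT Clay.
-/

noncomputable section

namespace YMDAG.N14.ConvexFibreMatching

open MeasureTheory ProbabilityTheory Set Filter Topology
open scoped RealInnerProductSpace ENNReal NNReal
open Literature.Analysis.FunctionSpaces (isProbabilityMeasure_tilted_neg)
open Summit.QuantumFields.BalabanUV.T4Continuum.NE1p.DressedMGFForm (tiltedMean TiltedMeanMatching)
open Summit.QuantumFields.BalabanUV.T4Continuum.NE1p.TiltedMeanInfluence (hasDerivAt_tiltedMean)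
open YMDAG.N14.ConvexFibreEngine (bornCumulant_le_of_uniformlyConvex)
open YMDAG.N14.ConvexFibreWindow (variance_tilted_le_of_uniformlyConvex)
open YMDAG.N14.ConvexFibreStep (measurable_fibreAvg abs_fibreAvg_le)
open YMDAG.N14.ConvexFibreTilt (compProd_tilted exists_tiltedKernel fibreMass_pos_measurable isProbabilityMeasure_tilted_fibreCumulant)

/-! ## §1 Generic tilt lemmas -/
section Generic

variable {Ω : Type*} [MeasurableSpace Ω] {ν : Measure Ω} [IsProbabilityMeasure ν] {F : Ω → ℝ} {B : ℝ}

/-- At tilt `0` the tilted mean is the mean. [folklore] -/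
theorem tiltedMean_zero_eq_integral (F : Ω → ℝ) : tiltedMean F ν 0 = ∫ ω, F ω ∂ν := by
  rw [tiltedMean]
  have h : (fun ω => (0 : ℝ) * F ω) = fun _ => (0 : ℝ) := funext fun _ => by simp
  rw [h, tilted_const]

/-- Hence the tilted mean under a class PIECE (a finite nonzero measure) is the tilted mean under its normalisation. [folklore] -/
theorem tiltedMean_smul_measure {α : Type*} [MeasurableSpace α] (F : α → ℝ) (μ : Measure α) {c : ℝ≥0∞} (hc0 : c ≠ 0) (hc : c ≠ ∞)
    (s : ℝ) : tiltedMean F (c • μ) s = tiltedMean F μ s := by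
  rw [tiltedMean, tiltedMean, Literature.Barriers.CriticalPhenomena.HierarchicalRG.tilted_smul_measure μ _ hc0 hc]

/-- **MEAN VALUE ON THE TILT WINDOW** [folklore]: if the tilted variances `Var[F; ν.tilted (τF)]` are `≤ v` for `|τ| ≤ |s|`, then
`|tiltedMean F ν s − ∫F dν| ≤ v·|s|` (`d∕dτ tiltedMean = ` tilted variance, `TiltedMeanInfluence.hasDerivAt_tiltedMean`). -/
theorem abs_tiltedMean_sub_integral_le (hFm : Measurable F) (hF : ∀ ω, |F ω| ≤ B) {v s : ℝ}
    (hv : ∀ τ : ℝ, |τ| ≤ |s| → Var[F; ν.tilted fun ω => τ * F ω] ≤ v) : |tiltedMean F ν s - ∫ ω, F ω ∂ν| ≤ v * |s| := by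
  rw [← tiltedMean_zero_eq_integral F]
  have hderiv : ∀ x ∈ Set.Icc (-|s|) |s|, HasDerivWithinAt (tiltedMean F ν) (Var[F; ν.tilted fun ω => x * F ω]) (Set.Icc (-|s|) |s|) x :=
    fun x _ => (hasDerivAt_tiltedMean (ν := ν) hFm hF x).hasDerivWithinAt
  have hbound : ∀ x ∈ Set.Icc (-|s|) |s|, ‖Var[F; ν.tilted fun ω => x * F ω]‖ ≤ v := fun x hx => by
    rw [Real.norm_eq_abs, abs_of_nonneg (variance_nonneg _ _)]
    exact hv x (abs_le.2 ⟨hx.1, hx.2⟩)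
  have h0 : (0 : ℝ) ∈ Set.Icc (-|s|) |s| := ⟨by simp, abs_nonneg s⟩
  have hs : s ∈ Set.Icc (-|s|) |s| := ⟨neg_abs_le s, le_abs_self s⟩
  have key := (convex_Icc (-|s|) |s|).norm_image_sub_le_of_norm_hasDerivWithin_le hderiv hbound h0 hs
  rw [Real.norm_eq_abs, Real.norm_eq_abs, sub_zero] at key
  exact key

/-- `e^{−y} ≥ 2 − e^{y}` (from `(e^{y} − 1)² ≥ 0` and `e^{y}e^{−y} = 1`). [folklore] -/
theorem two_sub_exp_le_exp_neg (y : ℝ) : 2 - Real.exp y ≤ Real.exp (-y) := by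
  have hprod : Real.exp y * Real.exp (-y) = 1 := by rw [← Real.exp_add, add_neg_cancel, Real.exp_zero]
  nlinarith [sq_nonneg (Real.exp y - 1), hprod, Real.exp_pos y, Real.exp_pos (-y),
    mul_pos (Real.exp_pos y) (Real.exp_pos (-y))]

/-- **TWO TILTS CLOSE IN SUP NORM GIVE CLOSE EXPECTATIONS** [folklore]: `f₁`, `f₂` bounded measurable with `|f₁ − f₂| ≤ δ` pointwise, `h`
measurable with `|h| ≤ H` ⇒ `|∫ h dν.tilted f₁ − ∫ h dν.tilted f₂| ≤ H·(e^{2δ} − 1)` (the two densities have ratio in `[e^{−2δ}, e^{2δ}]`). -/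
theorem abs_integral_tilted_sub_tilted_le {f₁ f₂ h : Ω → ℝ} {C₁ C₂ H δ : ℝ} (hf₁m : Measurable f₁) (hf₂m : Measurable f₂)
    (hf₁b : ∀ x, |f₁ x| ≤ C₁) (hf₂b : ∀ x, |f₂ x| ≤ C₂) (hhm : Measurable h) (hhb : ∀ x, |h x| ≤ H) (hδ : ∀ x, |f₁ x - f₂ x| ≤ δ) :
    |∫ x, h x ∂(ν.tilted f₁) - ∫ x, h x ∂(ν.tilted f₂)| ≤ H * (Real.exp (2 * δ) - 1) := by
  -- the two partition functions
  have hi₁ : Integrable (fun x => Real.exp (f₁ x)) ν := by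
    have := Literature.Probability.Moments.integrable_exp_mul_of_abs_le_const ν hf₁m hf₁b 1; simpa using this
  have hi₂ : Integrable (fun x => Real.exp (f₂ x)) ν := by
    have := Literature.Probability.Moments.integrable_exp_mul_of_abs_le_const ν hf₂m hf₂b 1; simpa using this
  set Z₁ : ℝ := ∫ x, Real.exp (f₁ x) ∂ν with hZ₁
  set Z₂ : ℝ := ∫ x, Real.exp (f₂ x) ∂ν with hZ₂
  have hZ₁pos : 0 < Z₁ := integral_exp_pos hi₁
  have hZ₂pos : 0 < Z₂ := integral_exp_pos hi₂
  -- `Z₁ ≤ e^{δ} Z₂` and `Z₂ ≤ e^{δ} Z₁`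
  have hZ12 : Z₁ ≤ Real.exp δ * Z₂ := by
    rw [hZ₁, hZ₂, ← integral_const_mul]
    refine integral_mono hi₁ (hi₂.const_mul _) fun x => ?_
    show Real.exp (f₁ x) ≤ Real.exp δ * Real.exp (f₂ x)
    rw [← Real.exp_add, Real.exp_le_exp]; linarith [(abs_le.1 (hδ x)).2]
  have hZ21 : Z₂ ≤ Real.exp δ * Z₁ := by
    rw [hZ₁, hZ₂, ← integral_const_mul]
    refine integral_mono hi₂ (hi₁.const_mul _) fun x => ?_
    show Real.exp (f₂ x) ≤ Real.exp δ * Real.exp (f₁ x)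
    rw [← Real.exp_add, Real.exp_le_exp]; linarith [(abs_le.1 (hδ x)).1]
  -- densities and the pointwise ratio bound `|ρ₁ − ρ₂| ≤ (e^{2δ} − 1) ρ₂`
  set ρ₁ : Ω → ℝ := fun x => Real.exp (f₁ x) / Z₁ with hρ₁
  set ρ₂ : Ω → ℝ := fun x => Real.exp (f₂ x) / Z₂ with hρ₂
  have hρ₂0 : ∀ x, 0 ≤ ρ₂ x := fun x => div_nonneg (Real.exp_pos _).le hZ₂pos.le
  have hup : ∀ x, ρ₁ x ≤ Real.exp (2 * δ) * ρ₂ x := fun x => by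
    have h1 : Real.exp (f₁ x) ≤ Real.exp δ * Real.exp (f₂ x) := by
      rw [← Real.exp_add, Real.exp_le_exp]; linarith [(abs_le.1 (hδ x)).2]
    -- `e^{f₁}/Z₁ ≤ e^{δ}e^{f₂}/Z₁ ≤ e^{δ}e^{f₂}·e^{δ}/Z₂`
    have h2 : Real.exp (f₁ x) / Z₁ ≤ Real.exp δ * Real.exp (f₂ x) / Z₁ := div_le_div_of_nonneg_right h1 hZ₁pos.le
    have h3 : Real.exp δ * Real.exp (f₂ x) / Z₁ ≤ Real.exp δ * Real.exp (f₂ x) * Real.exp δ / Z₂ := by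
      rw [div_le_div_iff₀ hZ₁pos hZ₂pos]
      have := mul_le_mul_of_nonneg_left hZ21 (show (0 : ℝ) ≤ Real.exp δ * Real.exp (f₂ x) by positivity)
      nlinarith [this]
    simp only [hρ₁, hρ₂]
    refine h2.trans (h3.trans (le_of_eq ?_))
    rw [show (2 : ℝ) * δ = δ + δ by ring, Real.exp_add]; ring
  have hlo : ∀ x, Real.exp (-(2 * δ)) * ρ₂ x ≤ ρ₁ x := fun x => by
    have h1 : Real.exp (f₂ x) ≤ Real.exp δ * Real.exp (f₁ x) := by
      rw [← Real.exp_add, Real.exp_le_exp]; linarith [(abs_le.1 (hδ x)).1]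
    -- `e^{−2δ} e^{f₂}/Z₂ ≤ e^{−2δ} e^{δ} e^{f₁}/Z₂ ≤ e^{−2δ}e^{δ}e^{f₁}·e^{δ}/Z₁ = e^{f₁}/Z₁`
    have h2 : Real.exp (-(2 * δ)) * (Real.exp (f₂ x) / Z₂) ≤ Real.exp (-(2 * δ)) * (Real.exp δ * Real.exp (f₁ x) / Z₂) :=
      mul_le_mul_of_nonneg_left (div_le_div_of_nonneg_right h1 hZ₂pos.le) (Real.exp_pos _).le
    have h3 : Real.exp (-(2 * δ)) * (Real.exp δ * Real.exp (f₁ x) / Z₂) ≤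
        Real.exp (-(2 * δ)) * (Real.exp δ * Real.exp (f₁ x) * Real.exp δ / Z₁) := by
      refine mul_le_mul_of_nonneg_left ?_ (Real.exp_pos _).le
      rw [div_le_div_iff₀ hZ₂pos hZ₁pos]
      have := mul_le_mul_of_nonneg_left hZ12 (show (0 : ℝ) ≤ Real.exp δ * Real.exp (f₁ x) by positivity)
      nlinarith [this]
    simp only [hρ₁, hρ₂]
    refine h2.trans (h3.trans (le_of_eq ?_))
    have e : Real.exp (-(2 * δ)) * (Real.exp δ * Real.exp δ) = 1 := by
      rw [← Real.exp_add, ← Real.exp_add, show -((2 : ℝ) * δ) + (δ + δ) = 0 by ring, Real.exp_zero]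
    calc Real.exp (-(2 * δ)) * (Real.exp δ * Real.exp (f₁ x) * Real.exp δ / Z₁)
        = Real.exp (-(2 * δ)) * (Real.exp δ * Real.exp δ) * (Real.exp (f₁ x) / Z₁) := by ring
      _ = Real.exp (f₁ x) / Z₁ := by rw [e, one_mul]
  have hratio : ∀ x, |h x * (ρ₁ x - ρ₂ x)| ≤ H * (Real.exp (2 * δ) - 1) * ρ₂ x := fun x => by
    rw [abs_mul]
    have hr : |ρ₁ x - ρ₂ x| ≤ (Real.exp (2 * δ) - 1) * ρ₂ x := by
      rw [abs_le]
      constructor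
      · nlinarith [hlo x, hρ₂0 x, two_sub_exp_le_exp_neg (2 * δ)]
      · nlinarith [hup x, hρ₂0 x]
    calc |h x| * |ρ₁ x - ρ₂ x| ≤ H * ((Real.exp (2 * δ) - 1) * ρ₂ x) := mul_le_mul (hhb x) hr (abs_nonneg _) ((abs_nonneg _).trans (hhb x))
      _ = H * (Real.exp (2 * δ) - 1) * ρ₂ x := by ring
  -- integrate
  have hρ₁i : Integrable ρ₁ ν := hi₁.div_const _
  have hρ₂i : Integrable ρ₂ ν := hi₂.div_const _
  have hdi : Integrable (fun x => h x * (ρ₁ x - ρ₂ x)) ν :=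
    (hρ₁i.sub hρ₂i).bdd_mul hhm.aestronglyMeasurable (Eventually.of_forall fun x => by rw [Real.norm_eq_abs]; exact hhb x)
  have hdiff : ∫ x, h x ∂(ν.tilted f₁) - ∫ x, h x ∂(ν.tilted f₂) = ∫ x, h x * (ρ₁ x - ρ₂ x) ∂ν := by
    rw [integral_tilted, integral_tilted, ← integral_sub]
    · refine integral_congr_ae (Eventually.of_forall fun x => ?_)
      simp only [smul_eq_mul, hρ₁, hρ₂]
      ring
    · exact hρ₁i.bdd_mul hhm.aestronglyMeasurable (Eventually.of_forall fun x => by rw [Real.norm_eq_abs]; exact hhb x) |>.congr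
        (Eventually.of_forall fun x => by simp only [smul_eq_mul, hρ₁]; ring)
    · exact hρ₂i.bdd_mul hhm.aestronglyMeasurable (Eventually.of_forall fun x => by rw [Real.norm_eq_abs]; exact hhb x) |>.congr
        (Eventually.of_forall fun x => by simp only [smul_eq_mul, hρ₂]; ring)
  rw [hdiff, ← Real.norm_eq_abs]
  refine (norm_integral_le_of_norm_le (hρ₂i.const_mul (H * (Real.exp (2 * δ) - 1))) (Eventually.of_forall fun x => by
    rw [Real.norm_eq_abs]; exact hratio x)).trans (le_of_eq ?_)
  rw [integral_const_mul]
  have hZ : ∫ x, ρ₂ x ∂ν = 1 := by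
    simp only [hρ₂]
    rw [integral_div, div_self hZ₂pos.ne']
  rw [hZ, mul_one]

end Generic

/-! ## §2 The two-run tilted mean matching across one convex fibre -/
section Step

variable {B : Type*} [MeasurableSpace B] {n : ℕ} {ν : Measure B} [IsProbabilityMeasure ν]
  {κ : Kernel B (EuclideanSpace ℝ (Fin n))} [IsMarkovKernel κ] {V G : B × EuclideanSpace ℝ (Fin n) → ℝ} {lam M l₀ s B₀ L : ℝ}

/-- **THE TWO-RUN TILTED MEAN MATCHING ACROSS ONE CONVEX FIBRE IS SECOND ORDER IN THE FIBRE GRADIENT** [folklore ∘ files A∕B∕E; cite: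
BakryGentilLedoux2014, Prop. 5.4.1 + Cor. 5.7.2; BrascampLieb1976, Thm 4.1 — all PROVED in the tree].  Run A: background law `ν` (any
probability space) with observable the FIBRE AVERAGE `Ḡ b = ∫ G (b,x) ∂(κ b)`; run B: `ν ⊗ₘ κ` with observable `G`, where `κ b = e^{−V(b,·)}dx∕Z_b`,
every `V (b,·) ∈ C¹` `λ`-uniformly convex (`λ > 0`), `G` measurable with `|G| ≤ B₀`, every `G (b,·) ∈ C¹` with fibre gradient `≤ L` (`L > 0`) and
the two-sided first-order letter `M`, `l₀M < λ`.  Then for every tilt `|s| ≤ l₀`: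
`|tiltedMean G (ν ⊗ₘ κ) s − tiltedMean Ḡ ν s| ≤ |s|·L²∕(λ − l₀M) + B₀·(e^{L²s²∕λ} − 1)` — BOTH terms O(L²): the young rate squared when
`L = L₀θ₁^K`.  ((a) tilted fibre mean vs fibre mean: mean value on the tilted fibre variance `≤ (λ − l₀M)⁻¹L²`; (b) background tilted by the
fibre cumulant `Λ_s` (via `compProd_tilted`) vs by `s·Ḡ`: `0 ≤ Λ_s − s·Ḡ ≤ (L²∕λ)s²∕2` by Jensen and Herbst.) -/
theorem abs_tiltedMean_compProd_sub_le (hlam : 0 < lam)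
    (hκ : ∀ b, κ b = (volume : Measure (EuclideanSpace ℝ (Fin n))).tilted fun x => -V (b, x))
    (hVc : ∀ b, ContDiff ℝ 1 fun x => V (b, x))
    (hV : ∀ b (x y : EuclideanSpace ℝ (Fin n)), V (b, x) + ⟪gradient (fun z => V (b, z)) x, y - x⟫ + lam / 2 * ‖y - x‖ ^ 2 ≤ V (b, y))
    (hZ : ∀ b, Integrable fun x => Real.exp (-V (b, x))) (hGm : Measurable G) (hG : ∀ b, ContDiff ℝ 1 fun x => G (b, x))
    (hGb : ∀ p, |G p| ≤ B₀) (hGD : ∀ b x, ‖fderiv ℝ (fun z => G (b, z)) x‖ ≤ L) (hL : 0 < L)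
    (hGlo : ∀ b (x y : EuclideanSpace ℝ (Fin n)), G (b, x) + ⟪gradient (fun z => G (b, z)) x, y - x⟫ - M / 2 * ‖y - x‖ ^ 2 ≤ G (b, y))
    (hGup : ∀ b (x y : EuclideanSpace ℝ (Fin n)), G (b, y) ≤ G (b, x) + ⟪gradient (fun z => G (b, z)) x, y - x⟫ + M / 2 * ‖y - x‖ ^ 2)
    (hlM : l₀ * M < lam) (hs : |s| ≤ l₀) :
    |tiltedMean G (ν ⊗ₘ κ) s - tiltedMean (fun b => ∫ x, G (b, x) ∂(κ b)) ν s| ≤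
      |s| * (L ^ 2 / (lam - l₀ * M)) + B₀ * (Real.exp (L ^ 2 * s ^ 2 / lam) - 1) := by
  have hlM' : 0 < lam - l₀ * M := sub_pos.2 hlM
  -- the fibre average `Ḡ`
  set Gbar : B → ℝ := fun b => ∫ x, G (b, x) ∂(κ b) with hGbar
  have hGbarm : Measurable Gbar := measurable_fibreAvg hGm
  have hGbarb : ∀ b, |Gbar b| ≤ B₀ := abs_fibreAvg_le hGb
  -- the tilt `f = s·G`, a measurable version `η` of the tilted fibres, the fibre cumulant `Λ`
  have hfm : Measurable fun p : B × EuclideanSpace ℝ (Fin n) => s * G p := hGm.const_mul s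
  have hfb : ∀ p : B × EuclideanSpace ℝ (Fin n), |s * G p| ≤ |s| * B₀ := fun p => by
    rw [abs_mul]; exact mul_le_mul_of_nonneg_left (hGb p) (abs_nonneg _)
  obtain ⟨η, hηM, hη⟩ := exists_tiltedKernel (κ := κ) hfm hfb
  obtain ⟨hZlo, hZhi, hZm⟩ := fibreMass_pos_measurable (κ := κ) hfm hfb
  set Λ : B → ℝ := fun b => Real.log (∫ x, Real.exp (s * G (b, x)) ∂(κ b)) with hΛ
  have hZpos : ∀ b, 0 < ∫ x, Real.exp (s * G (b, x)) ∂(κ b) := fun b => (Real.exp_pos _).trans_le (hZlo b)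
  have hΛm : Measurable Λ := Real.measurable_log.comp hZm
  have hΛb : ∀ b, |Λ b| ≤ |s| * B₀ := fun b => by
    rw [abs_le]
    constructor
    · have := Real.log_le_log (Real.exp_pos _) (hZlo b)
      rwa [Real.log_exp] at this
    · have := Real.log_le_log (hZpos b) (hZhi b)
      rwa [Real.log_exp] at this
  haveI : IsProbabilityMeasure (ν.tilted Λ) := isProbabilityMeasure_tilted_fibreCumulant (ν := ν) (κ := κ) hGm hGb s
  -- T1: the tilted composite mean is the background-tilted mean of the tilted fibre means
  have hT1 : tiltedMean G (ν ⊗ₘ κ) s = ∫ b, (∫ x, G (b, x) ∂(η b)) ∂(ν.tilted Λ) := by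
    rw [tiltedMean, compProd_tilted (ν := ν) (κ := κ) (η := η) hfm hfb hη]
    exact Measure.integral_compProd ((integrable_const B₀).mono' hGm.aestronglyMeasurable (Eventually.of_forall fun p => by
      rw [Real.norm_eq_abs]; exact hGb p))
  -- the inner integral is the fibre's tilted mean
  have hinner : ∀ b, ∫ x, G (b, x) ∂(η b) = tiltedMean (fun x => G (b, x)) (κ b) s := fun b => by rw [hη b, tiltedMean]
  -- (a) the tilted fibre mean is within `|s|·L²∕(λ − l₀M)` of the fibre mean
  have ha : ∀ b, |tiltedMean (fun x => G (b, x)) (κ b) s - Gbar b| ≤ L ^ 2 / (lam - l₀ * M) * |s| := fun b => by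
    refine abs_tiltedMean_sub_integral_le (ν := κ b) (hGm.comp measurable_prodMk_left) (fun x => hGb (b, x)) fun τ hτ => ?_
    have hτ' : |τ| ≤ l₀ := hτ.trans hs
    have h := variance_tilted_le_of_uniformlyConvex (V := fun x => V (b, x)) (G := fun x => G (b, x)) (hVc b) (hV b) (hZ b) (hG b)
      (fun x => hGb (b, x)) (hGD b) (hGlo b) (hGup b) hlM hτ'
    rw [← hκ b] at h
    rw [div_eq_inv_mul]
    exact h
  -- (b) the background tilts `Λ` and `s·Ḡ` differ by the fibre's born cumulant `∈ [0, (L²/λ)s²/2]`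
  have hδ : ∀ b, |Λ b - s * Gbar b| ≤ L ^ 2 * s ^ 2 / (2 * lam) := fun b => by
    have hcgf : Λ b = cgf (fun x => G (b, x)) (κ b) s := by rw [hΛ, cgf, mgf]
    have hup : cgf (fun x => G (b, x)) (κ b) s - s * Gbar b ≤ L ^ 2 / lam * s ^ 2 / 2 := by
      have h := bornCumulant_le_of_uniformlyConvex (V := fun x => V (b, x)) (G := fun x => G (b, x)) hlam (hVc b).continuous (hV b) (hZ b)
        (hG b) (fun x => hGb (b, x)) (hGD b) hL s
      rw [← hκ b] at h
      exact h
    have hlo : s * Gbar b ≤ cgf (fun x => G (b, x)) (κ b) s :=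
      Literature.MathematicalPhysics.QuantumFieldTheory.Balaban1983to89.T4DressingDefect.mul_integral_le_cgf
        (hGm.comp measurable_prodMk_left).aemeasurable (Eventually.of_forall fun x => hGb (b, x)) s
    rw [hcgf, abs_le]
    constructor
    · have : (0 : ℝ) ≤ L ^ 2 * s ^ 2 / (2 * lam) := by positivity
      linarith
    · have e : L ^ 2 / lam * s ^ 2 / 2 = L ^ 2 * s ^ 2 / (2 * lam) := by field_simp
      linarith
  have hb : |∫ b, Gbar b ∂(ν.tilted Λ) - ∫ b, Gbar b ∂(ν.tilted fun b => s * Gbar b)| ≤ B₀ * (Real.exp (L ^ 2 * s ^ 2 / lam) - 1) := by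
    have h := abs_integral_tilted_sub_tilted_le (ν := ν) hΛm (hGbarm.const_mul s) hΛb
      (fun b => by rw [abs_mul]; exact mul_le_mul_of_nonneg_left (hGbarb b) (abs_nonneg s)) hGbarm hGbarb hδ
    have e : (2 : ℝ) * (L ^ 2 * s ^ 2 / (2 * lam)) = L ^ 2 * s ^ 2 / lam := by field_simp
    rwa [e] at h
  -- assemble
  have hT2 : tiltedMean Gbar ν s = ∫ b, Gbar b ∂(ν.tilted fun b => s * Gbar b) := rfl
  have hsplit : tiltedMean G (ν ⊗ₘ κ) s - tiltedMean Gbar ν s =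
      (∫ b, (tiltedMean (fun x => G (b, x)) (κ b) s - Gbar b) ∂(ν.tilted Λ)) +
        (∫ b, Gbar b ∂(ν.tilted Λ) - ∫ b, Gbar b ∂(ν.tilted fun b => s * Gbar b)) := by
    rw [hT1, hT2]
    have hi1 : Integrable (fun b => tiltedMean (fun x => G (b, x)) (κ b) s) (ν.tilted Λ) := by
      have hm : Measurable fun b => tiltedMean (fun x => G (b, x)) (κ b) s := by
        have : (fun b => tiltedMean (fun x => G (b, x)) (κ b) s) = fun b => ∫ x, G (b, x) ∂(η b) := funext fun b => (hinner b).symm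
        rw [this]; exact measurable_fibreAvg (κ := η) hGm
      refine (integrable_const B₀).mono' hm.aestronglyMeasurable (Eventually.of_forall fun b => ?_)
      rw [Real.norm_eq_abs]
      exact Summit.QuantumFields.BalabanUV.T4Continuum.NE1p.TiltedMeanInfluence.abs_tiltedMean_le (fun x => hGb (b, x))
        ((abs_nonneg _).trans (hGb (b, 0))) s
    have hi2 : Integrable Gbar (ν.tilted Λ) :=
      (integrable_const B₀).mono' hGbarm.aestronglyMeasurable (Eventually.of_forall fun b => by rw [Real.norm_eq_abs]; exact hGbarb b)
    rw [integral_sub hi1 hi2]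
    simp only [hinner]
    ring
  rw [hsplit]
  refine (abs_add_le _ _).trans (add_le_add ?_ hb)
  -- |∫ (m_s − Ḡ)| ≤ sup ≤ (L²/(λ−l₀M))|s|
  rw [← Real.norm_eq_abs]
  refine (norm_integral_le_of_norm_le_const (C := L ^ 2 / (lam - l₀ * M) * |s|) (Eventually.of_forall fun b => ?_)).trans (le_of_eq ?_)
  · rw [Real.norm_eq_abs]; exact ha b
  · simp only [probReal_univ, mul_one]; ring

end Step

/-! ## §3 The binder on the consistent convex tower -/
section Tower

variable {ι : Type*} [DecidableEq ι] {Ω : ℕ → Type*} [∀ K, MeasurableSpace (Ω K)] {d : ℕ → ℕ}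
  {T : ℕ → Finset ι} {Bad : ℕ → ℝ → Finset ι} {l₀ B₀ lam M : ℝ} {L : ℕ → ℝ}
  {ν : ∀ K, ι → Measure (Ω K)} {κ : ∀ K, Kernel (Ω K) (EuclideanSpace ℝ (Fin (d K)))}
  {V G : ∀ K, Ω K × EuclideanSpace ℝ (Fin (d K)) → ℝ}

/-- **`TiltedMeanMatching` ON THE CONSISTENT CONVEX TOWER** [folklore ∘ §2].  For every depth `K`: run A = the class PIECES `ν K τ` on `Ω K`
(FINITE measures, as in `DressedMGFForm.MGFForm.finite`; the tilted means do not see the normalisation, `tiltedMean_smul_measure` via the tree's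
`HierarchicalRG.tilted_smul_measure`)
with observable the fibre average of `G K`; run B = `ν K τ ⊗ₘ κ K` on `Ω K × E_K` with observable `G K`, the fibre kernel `κ K` convex
(`e^{−V K (b,·)}dx∕Z`, every action `C¹` and `λ`-convex), `G K` measurable, `|G K| ≤ B₀`, fibrewise `C¹` with gradient size `L K > 0` and
two-sided letter `M`, `l₀M < λ`.  Then the residual binder of N14 holds on this tower:
`DressedMGFForm.TiltedMeanMatching l₀ T Bad (fibre averages) ν G (ν ⊗ₘ κ) (fun K => l₀·(L K)²∕(λ − l₀M) + B₀·(e^{(L K)²l₀²∕λ} − 1))` —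
SUMMABLE iff `Σ (L K)² < ∞`: the young rate squared for `L K = L₀θ₁^K`.  (The consistent-tower idealisation and the convexity are the
hypotheses; nothing of Bałaban's is instantiated.) -/
theorem tiltedMeanMatching_of_consistentConvexTower (hlam : 0 < lam) (hlM : l₀ * M < lam) (hB₀ : 0 ≤ B₀)
    (hν : ∀ K, ∀ τ ∈ T K, IsFiniteMeasure (ν K τ)) (hκM : ∀ K, IsMarkovKernel (κ K))
    (hκ : ∀ K b, κ K b = (volume : Measure (EuclideanSpace ℝ (Fin (d K)))).tilted fun x => -V K (b, x))
    (hVc : ∀ K b, ContDiff ℝ 1 fun x => V K (b, x))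
    (hV : ∀ K b (x y : EuclideanSpace ℝ (Fin (d K))),
      V K (b, x) + ⟪gradient (fun z => V K (b, z)) x, y - x⟫ + lam / 2 * ‖y - x‖ ^ 2 ≤ V K (b, y))
    (hZ : ∀ K b, Integrable fun x => Real.exp (-V K (b, x))) (hGm : ∀ K, Measurable (G K))
    (hG : ∀ K b, ContDiff ℝ 1 fun x => G K (b, x)) (hGb : ∀ K p, |G K p| ≤ B₀)
    (hGD : ∀ K b x, ‖fderiv ℝ (fun z => G K (b, z)) x‖ ≤ L K) (hL : ∀ K, 0 < L K)
    (hGlo : ∀ K b (x y : EuclideanSpace ℝ (Fin (d K))),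
      G K (b, x) + ⟪gradient (fun z => G K (b, z)) x, y - x⟫ - M / 2 * ‖y - x‖ ^ 2 ≤ G K (b, y))
    (hGup : ∀ K b (x y : EuclideanSpace ℝ (Fin (d K))),
      G K (b, y) ≤ G K (b, x) + ⟪gradient (fun z => G K (b, z)) x, y - x⟫ + M / 2 * ‖y - x‖ ^ 2) :
    TiltedMeanMatching l₀ T Bad (fun K b => ∫ x, G K (b, x) ∂(κ K b)) ν G (fun K τ => ν K τ ⊗ₘ κ K)
      (fun K => l₀ * (L K ^ 2 / (lam - l₀ * M)) + B₀ * (Real.exp (L K ^ 2 * l₀ ^ 2 / lam) - 1)) := by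
  intro K t _ τ hτ s hs
  have hτT : τ ∈ T K := (Finset.mem_sdiff.mp hτ).1
  haveI := hν K τ hτT
  haveI := hκM K
  have hlM' : 0 < lam - l₀ * M := sub_pos.2 hlM
  have hl₀ : 0 ≤ l₀ := (abs_nonneg s).trans hs
  have hη0 : 0 ≤ l₀ * (L K ^ 2 / (lam - l₀ * M)) + B₀ * (Real.exp (L K ^ 2 * l₀ ^ 2 / lam) - 1) := by
    have : (1 : ℝ) ≤ Real.exp (L K ^ 2 * l₀ ^ 2 / lam) := Real.one_le_exp (by positivity)
    have h2 : 0 ≤ B₀ * (Real.exp (L K ^ 2 * l₀ ^ 2 / lam) - 1) := mul_nonneg hB₀ (by linarith)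
    positivity
  -- a class piece of mass zero: both tilted means vanish
  by_cases h0 : ν K τ = 0
  · simp only [h0, Measure.compProd_zero_left, tiltedMean, tilted_zero_measure, integral_zero_measure, sub_zero, abs_zero]
    exact hη0
  -- otherwise normalise the class piece (the tilted means do not see the normalisation) and use the probability case
  set c : ℝ≥0∞ := ν K τ Set.univ with hc
  have hc0 : c ≠ 0 := by rwa [hc, Ne, Measure.measure_univ_eq_zero]
  have hcT : c ≠ ∞ := measure_ne_top _ _
  have hci0 : c⁻¹ ≠ 0 := ENNReal.inv_ne_zero.2 hcT
  have hciT : c⁻¹ ≠ ∞ := ENNReal.inv_ne_top.2 hc0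
  haveI : IsProbabilityMeasure (c⁻¹ • ν K τ) :=
    ⟨by rw [Measure.smul_apply, smul_eq_mul, hc, ENNReal.inv_mul_cancel hc0 hcT]⟩
  have e1 : tiltedMean (fun b => ∫ x, G K (b, x) ∂(κ K b)) (ν K τ) s = tiltedMean (fun b => ∫ x, G K (b, x) ∂(κ K b)) (c⁻¹ • ν K τ) s :=
    (tiltedMean_smul_measure _ _ hci0 hciT s).symm
  have e2 : tiltedMean (G K) (ν K τ ⊗ₘ κ K) s = tiltedMean (G K) ((c⁻¹ • ν K τ) ⊗ₘ κ K) s := by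
    rw [Measure.compProd_smul_left, tiltedMean_smul_measure _ _ hci0 hciT]
  rw [e1, e2]
  have hmain := abs_tiltedMean_compProd_sub_le (ν := c⁻¹ • ν K τ) (κ := κ K) hlam (hκ K) (hVc K) (hV K) (hZ K) (hGm K) (hG K) (hGb K)
    (hGD K) (hL K) (hGlo K) (hGup K) hlM hs
  refine hmain.trans (add_le_add ?_ ?_)
  · exact mul_le_mul_of_nonneg_right hs (by positivity)
  · refine mul_le_mul_of_nonneg_left ?_ hB₀
    have hss : s ^ 2 ≤ l₀ ^ 2 := by
      rw [← sq_abs s]; exact pow_le_pow_left₀ (abs_nonneg s) hs 2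
    have : L K ^ 2 * s ^ 2 / lam ≤ L K ^ 2 * l₀ ^ 2 / lam :=
      div_le_div_of_nonneg_right (mul_le_mul_of_nonneg_left hss (sq_nonneg _)) hlam.le
    linarith [Real.exp_le_exp.2 this]

end Tower

end YMDAG.N14.ConvexFibreMatching

end
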